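import Mathlib
import HarnessLib
import Summits.HubbardSuperconductivity.HubbardSuperconductivity.Theorems.KLProgrammeKLRegimeVolumeLimitHOscTOfChildren
import Summits.HubbardSuperconductivity.HubbardSuperconductivity.Theorems.KLProgrammeKLRegimeBetaSplitV17F2
import Summits.HubbardSuperconductivity.HubbardSuperconductivity.Theorems.KLProgrammeKLRegimeRenormFlowV17F2

/-!
# Route `KLProgramme` — VL item stmt-HubbardSuperconductivity-23356 `KLRegimeVolumeLimitV17F3`, atom HOsc′ / HOscT′ (registered v12W-7 stub `stub_vl_flowPieceOscTE`):
# the two CLOSED children discharged — the atom modulo the ENGINE-WITH-OSC-EXPORT ALONE (cell gate-hubbard-kl, seat p2 g25)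

`hoscAtom_of_children` / `hoscTAtom_of_children` (…VolumeLimitHOscOfChildren / …HOscTOfChildren) take `BetaSplitP klPredsV17F2 klWindowC` and
`CountertermP2 klPredsV17F2 klWindowC` as hypotheses; both are LANDED THEOREMS (`betaSplitP_klPredsV17F2 klWindowC`, item 20438, …KLRegimeBetaSplitV17F2;
`countertermP2_klPredsV17F2_holds`, item 20439, …KLRegimeRenormFlowV17F2).  Discharging them leaves ONE hypothesis, ENG-OSC (the text of `EngineP4 klPredsV17F2 klWindowC`
with the (K5′) osc export, = `engineP4Osc_klPredsV17F2_of_stubs_v2x` of the r16 image the day 20437 lands):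
* **`hoscAtom_of_engineOsc`** `: ENG-OSC → HOsc′`;  **`hoscTAtom_of_engineOsc`** `: ENG-OSC → HOscT′` (= the registered v12W-7 text of `stub_vl_flowPieceOscTE`).
Pure composition; nothing here asserts ENG-OSC, HOsc′, any stub, VL, K3 or superconductivity.
References: BGM 2006 §2.4 (2.36) [cite: BenfattoGiulianiMastropietro2006].
-/

noncomputable section

namespace Summit.HubbardSuperconductivity.HubbardSuperconductivity.Theorems.KLRegimeSplit

set_option linter.dupNamespace false -- summit = problem name (single-conjunct summit), D-0017

open Real Literature.MathematicalPhysics.QuantumLattice Literature.Probability.LatticeModels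
open Literature.MathematicalPhysics.QuantumLattice.FermiRG
open Summit.HubbardSuperconductivity.HubbardSuperconductivity.Theorems.KLProgrammeLegKernels
open Summit.HubbardSuperconductivity.HubbardSuperconductivity.Theorems.DispersionFlow

/-- **HOsc′ FROM THE ENGINE-WITH-OSC-EXPORT ALONE** (children 1, 2 discharged by their landed closers). [cite: BenfattoGiulianiMastropietro2006, §2.4 (2.36)] -/
theorem hoscAtom_of_engineOsc
    (hE : ∃ G : GeoConsts, G.WF ∧ ∀ P : SplitConsts, P.WF → ∀ R : RenConsts, R.WF2 → ∃ Q : EngConsts, Q.WF ∧ ∃ c₃ : ℝ, 0 < c₃ ∧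
      ∃ c'' : ℝ, 0 ≤ c'' ∧ ∀ c : ℝ, 0 < c → c ≤ c₃ →
        ∃ U₀ : ℝ, 0 < U₀ ∧ ∃ L₃ : ℝ → ℝ → ℕ, ∃ M₃ : ℝ → ℝ → ℕ → ℕ,
          ∀ μ ∈ klWindowC, ∀ U : ℝ, 0 < U → U ≤ U₀ → ∀ β : ℝ, klBetaMin ≤ β → β ≤ Real.exp (c / U ^ 2) →
            ∀ K : TrigPolyC4v, klPredsV17F2.frameOK R U (nScales β) μ K →
              ∀ (L M : ℕ) [NeZero L] [NeZero M], L₃ β U ≤ L → M₃ β U L ≤ M →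
                ∀ n : ℕ, n ≤ nScales β + 1 → IsKLRegime U c (-(n : ℤ)) → HistP klPredsV17F2 L M G P Q R β U μ K n →
                  (klPredsV17F2.engine L M G P Q β U μ K n ∧ klPredsV17F2.twoLeg L M G P Q R β U μ K n) ∧
                    ∀ m : ℕ, 1 ≤ m → m < n → FlowPieceOscAt L M c'' β U μ m) :
    ∀ (P : SplitConsts) (R : RenConsts), P.WF → R.WF2 →
      ∃ c'' : ℝ, 0 ≤ c'' ∧ ∃ c₇ : ℝ, 0 < c₇ ∧ ∀ c : ℝ, 0 < c → c ≤ c₇ → ∃ U₇ : ℝ, 0 < U₇ ∧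
        ∀ μ ∈ klWindowC, ∀ U : ℝ, 0 < U → U ≤ U₇ → ∀ β : ℝ, klBetaMin ≤ β → β ≤ Real.exp (c / U ^ 2) →
          ∃ L₂ : ℕ, ∃ M₂ : ℕ → ℕ, ∀ (L M : ℕ) [NeZero L] [NeZero M], L₂ ≤ L → M₂ L ≤ M →
            ∀ m : ℕ, 1 ≤ m → m < nScales β + 1 → FlowPieceOscAt L M c'' β U μ m :=
  hoscAtom_of_children (betaSplitP_klPredsV17F2 klWindowC) countertermP2_klPredsV17F2_holds hE

/-- **HOscT′ (= v12W-7 `stub_vl_flowPieceOscTE`) FROM THE ENGINE-WITH-OSC-EXPORT ALONE** (children 1, 2 discharged). [cite: BenfattoGiulianiMastropietro2006, §2.4 (2.36)] -/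
theorem hoscTAtom_of_engineOsc
    (hE : ∃ G : GeoConsts, G.WF ∧ ∀ P : SplitConsts, P.WF → ∀ R : RenConsts, R.WF2 → ∃ Q : EngConsts, Q.WF ∧ ∃ c₃ : ℝ, 0 < c₃ ∧
      ∃ c'' : ℝ, 0 ≤ c'' ∧ ∀ c : ℝ, 0 < c → c ≤ c₃ →
        ∃ U₀ : ℝ, 0 < U₀ ∧ ∃ L₃ : ℝ → ℝ → ℕ, ∃ M₃ : ℝ → ℝ → ℕ → ℕ,
          ∀ μ ∈ klWindowC, ∀ U : ℝ, 0 < U → U ≤ U₀ → ∀ β : ℝ, klBetaMin ≤ β → β ≤ Real.exp (c / U ^ 2) →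
            ∀ K : TrigPolyC4v, klPredsV17F2.frameOK R U (nScales β) μ K →
              ∀ (L M : ℕ) [NeZero L] [NeZero M], L₃ β U ≤ L → M₃ β U L ≤ M →
                ∀ n : ℕ, n ≤ nScales β + 1 → IsKLRegime U c (-(n : ℤ)) → HistP klPredsV17F2 L M G P Q R β U μ K n →
                  (klPredsV17F2.engine L M G P Q β U μ K n ∧ klPredsV17F2.twoLeg L M G P Q R β U μ K n) ∧
                    ∀ m : ℕ, 1 ≤ m → m < n → FlowPieceOscAt L M c'' β U μ m) :
    ∀ (G : GeoConsts) (P : SplitConsts) (Q : EngConsts) (R : RenConsts), P.WF → R.WF2 →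
      ∃ c'' : ℝ, 0 ≤ c'' ∧ ∃ c₇ : ℝ, 0 < c₇ ∧ ∀ c : ℝ, 0 < c → c ≤ c₇ → ∃ U₇ : ℝ, 0 < U₇ ∧
        ∀ μ ∈ klWindowC, ∀ U : ℝ, 0 < U → U ≤ U₇ → ∀ β : ℝ, klBetaMin ≤ β → β ≤ Real.exp (c / U ^ 2) →
          ∀ (K : TrigPolyC4v) (Lstar : ℕ) (Mstar : ℕ → ℕ), TowerP klPredsV17F2 G P Q R β U μ K Lstar Mstar →
          ∃ L₂ : ℕ, ∃ M₂ : ℕ → ℕ, ∀ (L M : ℕ) [NeZero L] [NeZero M], L₂ ≤ L → M₂ L ≤ M →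
            ∀ m : ℕ, 1 ≤ m → m < nScales β + 1 → FlowPieceOscAt L M c'' β U μ m :=
  hoscTAtom_of_children (betaSplitP_klPredsV17F2 klWindowC) countertermP2_klPredsV17F2_holds hE

end Summit.HubbardSuperconductivity.HubbardSuperconductivity.Theorems.KLRegimeSplit

end
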